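import Summits.HodgeConjecture.HodgeConjecture.Theorems.R90S4TwistedTubeFibres        -- ★ p864729 (R90-C131-p03 g3) 2a: frame `Ψ hΨ s hsm hsN R …`; brings ★ PART 1 `R90S4TwistedTubeTransversal` (`sum_sheet_classEpsOrbitalIntegral_mul_eq`, `isEpsRegularAt_of_mem_sheetTransversal`), ★ M1 `continuous_twistedConjFamily`, ★ `continuous_epsLoc`, `isClosed_epsCentralizer`
import Summits.HodgeConjecture.HodgeConjecture.Theorems.R90S4TwistedTubeOrbitalBase   -- ★ β CAN-ID (R90-C131-p03 g2): `IsEpsCanonicalAt.classEpsOrbitalIntegral_mk_eq_integral_descEpsConj_base`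
import HarnessLib

/-!
# R90-TF · S4 «Ch. 13.1–2», T-WIF road, brick (MEAS-Φst) — THE TORUS-SIDE INTEGRAND `t ↦ Φ^{st}_ε(sec₀ t, φ) · β(sec₀ t)` OF THE TWISTED WEYL INTEGRATION FORMULA IS
# a.e.-STRONGLY MEASURABLE ON `T^{reg}` (Rogawski 1990, §12.5 p. 186; §4.10 (4.10.1) p. 57)

Cell `hodgecm-mathlib`, crux H413 (`stmt-HodgeConjecture-24833`, lane `--supports … --as helper`), route of record `HCCMUnconditional` (no route verbs; count-neutral).
Programme R90-TF, section S4 = [Rogawski1990] Ch. 13.1–13.2.  Seat K2E3-p36 (g4); card (MEAS-Φst) of R90-C131-p03 (g3)'s carve list (2026-09-05T02:53:06Z (3)), dealt by the S4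
dealer K2E2-plan (g8) (S4-R57 (2)); census `K2/K2E3-p36/g4/CENSUS-MEAS-PhiSt.md`.  THEOREMS ONLY — no `def`, no instance, no notation, no named-fact hypothesis, no `sorry`; ★-only
imports (★ 2a `R90S4TwistedTubeFibres`, ★ β `R90S4TwistedTubeOrbitalBase`).

HONEST LABEL: HC_CM is proved only modulo the 7 printed citations (2 remaining named inputs: hLiu418 = stmt-HodgeConjecture-24832, h413 = stmt-HodgeConjecture-24833)
until rung 0 closes.  Descriptive measure theory at the S4 carriers; CONDITIONAL on the letters (L2) (Borel norm section `s`), the `K_T`-representatives `R` and the ε-canonical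
family `hcan` — hypotheses; discharges no socket ((B1), (J̃♭), (W-NP) untouched; REL ≠ ★ ≠ BUILT).

## The mathematics

SETTING = ★ 2a's frame (`T = Z_{G_v}(γ₀)`, `T̃ = Cent_{G̃_v}(γ₀)`, ε-regular base point `δ₀ ∈ T̃`, `T′ = G̃_{δ₀ε}`, the twisted family `Ψ(x T′, b) = x b ε(x)⁻¹` on `(G̃_v ⧸ T′) × T̃` as a
binder with its defining equation `hΨ`, the Borel norm section `s` and representatives `R` of PART 1) plus ★ β's CAN-ID data (`νGt`, an ε-canonical family `mGt`, the normalised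
Haar measure `τ₀` of `T′`, `μ₀ := dνGt ∕ dτ₀` on `G̃_v ⧸ T′`).  The right-hand side of the twisted Weyl integration formula [Rogawski1990, §12.5 p. 186] on the Cartan `T` is
`∫_{T^{reg}} D(t) · Φ^{st}_ε(sec₀ t, φ) · β(sec₀ t) dt` for an ARBITRARY everywhere-norm section `sec₀` (no measurability of `sec₀` is available or needed).  THIS FILE proves that the
integrand `t ↦ Φ^{st}_ε(sec₀ t, φ) · β(sec₀ t)` is a.e.-strongly measurable on `T^{reg}` for every measure on `T`, every Borel `φ` and every Borel ε-stable `β`, in three steps: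
* §1 for EVERY coset `q` and every `b ∈ T̃` the descended integrand on the base quotient IS `φ ∘ Ψ`: `descEpsConj ε ↑b T′ φ q = φ (Ψ (q, b))` (`hΨ` at the representative `out q`;
  the `Quotient.out` of ★ `descEpsConj` disappears into the binder `Ψ`), hence by Fubini (Mathlib `StronglyMeasurable.integral_prod_right'`, `Ψ` continuous ★ M1) the base
  integral `t ↦ ∫ φ(Ψ(q, s(t) u)) dμ₀(q)` along each sheet `t ↦ s(t) u` is strongly measurable in `t` for any s-finite `μ₀`;
* §2 on `T^{reg}` the point `s(t) u` is ε-regular (★ PART 1), so ★ β CAN-ID turns `Φ_ε(⟦s(t) u⟧, φ)` into that base integral against THE measure `μ₀ = dνGt ∕ dτ₀` — the sheet sum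
  `Σ_{u ∈ R} Φ_ε(⟦s(t) u⟧, φ) β(s(t) u)` is a.e.-strongly measurable on `T^{reg}`;
* §3 ★ PART 1 `sum_sheet_classEpsOrbitalIntegral_mul_eq` identifies the sheet sum with `Φ^{st}_ε(sec₀ t, φ) β(sec₀ t)` pointwise on `T^{reg}` (any `sec₀` with `N`-pairing) — the HEAD.
So the RHS of (B1) ∕ (W-NP) is an honest Bochner integral; PART 3 `R90S4TwistedTubeFormula` consumes the head BY NAME instead of a `hmeas` hypothesis.

[cite: Rogawski1990, §12.5 p. 186; §4.10 (4.10.1) p. 57; §3.11 Prop. 3.11.2 pp. 34–35] [cite: DeitmarEchterhoff2014, Thm. 1.5.3]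
-/

set_option autoImplicit false
-- the mandated namespace repeats the single-problem summit's segment (`HodgeConjecture.HodgeConjecture`)
set_option linter.dupNamespace false

noncomputable section

open MeasureTheory Measure Set Filter Topology Function NumberField IsDedekindDomain
open scoped ENNReal NNReal MatrixGroups Pointwise

namespace Summit.HodgeConjecture.HodgeConjecture.R90.S4

open Literature.NumberTheory.Rogawski1990 Literature.NumberTheory.Rogawski1990.Ch4Sec10
open Literature.NumberTheory.Automorphic Literature.NumberTheory.Automorphic.UnitaryGroup
open Literature.MeasureTheory.Group

section MeasPhiSt

variable {L : Type} [Field L] [NumberField L] [IsCMField L] {v : HeightOneSpectrum (𝓞 ↥(maximalRealSubfield L))}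
  (hns : ∀ w : PlacesOver L v, IsCMField.complexConj L • w.1 = w.1)
  {T : Subgroup ((UnitaryGroup.cmDatum L 3 (splitFormGL L : Matrix (Fin 3) (Fin 3) L)).Local v)}
  {γ₀ : (UnitaryGroup.cmDatum L 3 (splitFormGL L : Matrix (Fin 3) (Fin 3) L)).Local v} (hγ₀ : IsRegularElt (γ₀.val : GtLoc L v))
  (hT : T = Subgroup.centralizer ({γ₀} : Set ((UnitaryGroup.cmDatum L 3 (splitFormGL L : Matrix (Fin 3) (Fin 3) L)).Local v)))
  [LocallyCompactSpace (GtLoc L v)] [SecondCountableTopology (GtLoc L v)] [T2Space (GtLoc L v)] [MeasurableSpace (GtLoc L v)] [BorelSpace (GtLoc L v)]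
  [∀ δ : GtLoc L v, MeasurableSpace (GtLoc L v ⧸ epsCentralizer (epsLoc L (splitFormGL L) v) δ)]
  [∀ δ : GtLoc L v, BorelSpace (GtLoc L v ⧸ epsCentralizer (epsLoc L (splitFormGL L) v) δ)]
  [MeasurableSpace ((UnitaryGroup.cmDatum L 3 (splitFormGL L : Matrix (Fin 3) (Fin 3) L)).Local v)] [BorelSpace ((UnitaryGroup.cmDatum L 3 (splitFormGL L : Matrix (Fin 3) (Fin 3) L)).Local v)]
  {δ₀ : GtLoc L v} (hδ₀T : δ₀ ∈ Subgroup.centralizer ({(γ₀.val : GtLoc L v)} : Set (GtLoc L v))) (hδ₀reg : IsEpsRegularAt L (splitFormGL L) v δ₀)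
  (Ψ : (GtLoc L v ⧸ epsCentralizer (epsLoc L (splitFormGL L) v) δ₀) × ↥(Subgroup.centralizer ({(γ₀.val : GtLoc L v)} : Set (GtLoc L v))) → GtLoc L v)
  (hΨ : ∀ (x : GtLoc L v) (b : ↥(Subgroup.centralizer ({(γ₀.val : GtLoc L v)} : Set (GtLoc L v)))), Ψ (QuotientGroup.mk x, b) = x * b * (epsLoc L (splitFormGL L) v x)⁻¹)
  (s : ↥T → ↥(Subgroup.centralizer ({(γ₀.val : GtLoc L v)} : Set (GtLoc L v)))) (hsm : Measurable s)
  (hsN : ∀ t : ↥T, epsNorm (epsLoc L (splitFormGL L) v) (s t : GtLoc L v) = ((t : (UnitaryGroup.cmDatum L 3 (splitFormGL L : Matrix (Fin 3) (Fin 3) L)).Local v)).val)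
  (R : Finset ↥(Subgroup.centralizer ({(γ₀.val : GtLoc L v)} : Set (GtLoc L v))))
  (hRN : ∀ u ∈ R, epsNorm (epsLoc L (splitFormGL L) v) (u : GtLoc L v) = 1)
  (hRcov : ∀ w : ↥(Subgroup.centralizer ({(γ₀.val : GtLoc L v)} : Set (GtLoc L v))), epsNorm (epsLoc L (splitFormGL L) v) (w : GtLoc L v) = 1 →
    ∃ u ∈ R, ∃ a : ↥(Subgroup.centralizer ({(γ₀.val : GtLoc L v)} : Set (GtLoc L v))), (w : GtLoc L v) = u * (a * (epsLoc L (splitFormGL L) v a)⁻¹))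
  (hRinj : ∀ u ∈ R, ∀ u' ∈ R, (∃ a : ↥(Subgroup.centralizer ({(γ₀.val : GtLoc L v)} : Set (GtLoc L v))),
    ((u' : ↥(Subgroup.centralizer ({(γ₀.val : GtLoc L v)} : Set (GtLoc L v)))) : GtLoc L v) = u * (a * (epsLoc L (splitFormGL L) v a)⁻¹)) → u = u')
  {νGt : Measure (GtLoc L v)} [νGt.IsHaarMeasure] [νGt.IsMulRightInvariant]
  {mGt : EpsOrbitalMeasureFamily (epsLoc L (splitFormGL L) v) ⊥}

/-! ## §1 The descended twisted integrand on the base quotient is `φ ∘ Ψ`; Fubini measurability along a sheet -/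

omit [LocallyCompactSpace (GtLoc L v)] [SecondCountableTopology (GtLoc L v)] [T2Space (GtLoc L v)] [MeasurableSpace (GtLoc L v)] [BorelSpace (GtLoc L v)]
  [∀ δ : GtLoc L v, MeasurableSpace (GtLoc L v ⧸ epsCentralizer (epsLoc L (splitFormGL L) v) δ)]
  [∀ δ : GtLoc L v, BorelSpace (GtLoc L v ⧸ epsCentralizer (epsLoc L (splitFormGL L) v) δ)]
  [MeasurableSpace ((UnitaryGroup.cmDatum L 3 (splitFormGL L : Matrix (Fin 3) (Fin 3) L)).Local v)] [BorelSpace ((UnitaryGroup.cmDatum L 3 (splitFormGL L : Matrix (Fin 3) (Fin 3) L)).Local v)]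
  [νGt.IsHaarMeasure] [νGt.IsMulRightInvariant] in
include hΨ in
/-- **The descended twisted integrand on the base quotient `G̃_v ⧸ T′` is `φ ∘ Ψ`**: for EVERY coset `q` and every `b ∈ T̃`, `descEpsConj ε ↑b T′ φ q = φ (Ψ (q, b))` — ★ `descEpsConj` reads
its coset at the representative `out q`, and `hΨ` at `x := out q` is exactly that reading (`mk (out q) = q`); no well-definedness (`T′ ≤ G̃_{bε}`) is needed for this identity.
[cite: Rogawski1990, §4.10 (4.10.1) p. 57; §12.5 p. 186] -/
theorem descEpsConj_coe_base_eq_apply_epsTube {α : Type*} (φ : GtLoc L v → α) (b : ↥(Subgroup.centralizer ({(γ₀.val : GtLoc L v)} : Set (GtLoc L v))))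
    (q : GtLoc L v ⧸ epsCentralizer (epsLoc L (splitFormGL L) v) δ₀) :
    descEpsConj (epsLoc L (splitFormGL L) v) (b : GtLoc L v) (epsCentralizer (epsLoc L (splitFormGL L) v) δ₀) φ q = φ (Ψ (q, b)) := by
  conv_rhs => rw [← QuotientGroup.out_eq' q]
  rw [hΨ]
  rfl

omit [LocallyCompactSpace (GtLoc L v)] [T2Space (GtLoc L v)]
  [∀ δ : GtLoc L v, BorelSpace (GtLoc L v ⧸ epsCentralizer (epsLoc L (splitFormGL L) v) δ)]
  [BorelSpace ((UnitaryGroup.cmDatum L 3 (splitFormGL L : Matrix (Fin 3) (Fin 3) L)).Local v)]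
  [νGt.IsHaarMeasure] [νGt.IsMulRightInvariant] in
include hΨ hsm in
/-- **FUBINI MEASURABILITY ALONG A SHEET**: for Borel `φ : G̃_v → ℂ`, any s-finite measure `μ₀` on the base quotient `G̃_v ⧸ T′` and any `u ∈ T̃`, the base integral of the descended twisted
integrand along the sheet `t ↦ s(t) u` — `t ↦ ∫ φ(x (s(t) u) ε(x)⁻¹) dμ₀(x T′)` — is strongly measurable in `t ∈ T`: by §1 the integrand is `(t, q) ↦ φ (Ψ (q, s(t) u))`, jointly Borel
(`Ψ` is continuous ★ M1 `continuous_twistedConjFamily`, `s` is Borel), and Mathlib's `StronglyMeasurable.integral_prod_right'` applies. [cite: Rogawski1990, §12.5 p. 186; §4.10 (4.10.1) p. 57] -/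
theorem stronglyMeasurable_integral_descEpsConj_sheet [BorelSpace (GtLoc L v ⧸ epsCentralizer (epsLoc L (splitFormGL L) v) δ₀)]
    (φ : GtLoc L v → ℂ) (hφ : Measurable φ)
    (μ₀ : Measure (GtLoc L v ⧸ epsCentralizer (epsLoc L (splitFormGL L) v) δ₀)) [SFinite μ₀]
    (u : ↥(Subgroup.centralizer ({(γ₀.val : GtLoc L v)} : Set (GtLoc L v)))) :
    StronglyMeasurable fun t : ↥T =>
      ∫ q, descEpsConj (epsLoc L (splitFormGL L) v) ((s t * u : ↥(Subgroup.centralizer ({(γ₀.val : GtLoc L v)} : Set (GtLoc L v)))) : GtLoc L v)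
        (epsCentralizer (epsLoc L (splitFormGL L) v) δ₀) φ q ∂μ₀ := by
  haveI : SecondCountableTopology (GtLoc L v ⧸ epsCentralizer (epsLoc L (splitFormGL L) v) δ₀) :=
    (QuotientGroup.isQuotientMap_mk _).secondCountableTopology QuotientGroup.isOpenMap_coe
  have hΨc : Continuous Ψ :=
    continuous_twistedConjFamily (epsLoc L (splitFormGL L) v) _ Subtype.val Ψ hΨ (continuous_epsLoc L (splitFormGL L) v) continuous_subtype_val
  -- the joint integrand `(t, q) ↦ φ (Ψ (q, s t * u))` is Borel
  have hH : Measurable fun p : ↥T × (GtLoc L v ⧸ epsCentralizer (epsLoc L (splitFormGL L) v) δ₀) => φ (Ψ (p.2, s p.1 * u)) :=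
    hφ.comp (hΨc.measurable.comp (measurable_snd.prodMk ((hsm.comp measurable_fst).mul_const u)))
  have key := hH.stronglyMeasurable.integral_prod_right' (ν := μ₀)
  have heq : (fun t : ↥T => ∫ q, descEpsConj (epsLoc L (splitFormGL L) v) ((s t * u : ↥(Subgroup.centralizer ({(γ₀.val : GtLoc L v)} : Set (GtLoc L v)))) : GtLoc L v)
        (epsCentralizer (epsLoc L (splitFormGL L) v) δ₀) φ q ∂μ₀)
      = fun t : ↥T => ∫ q, (fun p : ↥T × (GtLoc L v ⧸ epsCentralizer (epsLoc L (splitFormGL L) v) δ₀) => φ (Ψ (p.2, s p.1 * u))) (t, q) ∂μ₀ := by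
    funext t
    exact integral_congr_ae (Eventually.of_forall fun q => descEpsConj_coe_base_eq_apply_epsTube Ψ hΨ φ (s t * u) q)
  rw [heq]
  exact key

/-! ## §2 The sheet sum `Σ_{u ∈ R} Φ_ε(⟦s(t) u⟧, φ) β(s(t) u)` is a.e.-strongly measurable on `T^{reg}` -/

include hns hγ₀ hδ₀T hδ₀reg hΨ hsm hsN hRN in
/-- **THE SHEET SUM IS a.e.-STRONGLY MEASURABLE ON `T^{reg}`**: for an ε-canonical family `mGt` (★ β CAN-ID at the base point `δ₀` with its normalised Haar measure `τ₀`), Borel `φ, β` and any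
measure `μ` on `T`, `t ↦ Σ_{u ∈ R} Φ_ε(⟦s(t) u⟧, φ) · β(s(t) u)` is a.e.-strongly measurable for `μ|_{T^{reg}}`.  On `T^{reg}` each `s(t) u` is ε-regular (★ PART 1), so CAN-ID rewrites the
summand as the base integral of §1 against THE measure `dνGt ∕ dτ₀` (s-finite: a regular measure on the second countable locally compact quotient); `T^{reg}` is Borel (open, `hns`).
[cite: Rogawski1990, §12.5 p. 186; §4.10 (4.10.1) p. 57; §4.3 (4.3.1) p. 43] [cite: DeitmarEchterhoff2014, Thm. 1.5.3] -/
theorem aestronglyMeasurable_sum_sheet_classEpsOrbitalIntegral_mul (hcan : IsEpsCanonicalAt L (splitFormGL L) v νGt mGt)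
    (τ₀ : Measure ↥(epsCentralizer (epsLoc L (splitFormGL L) v) δ₀)) [τ₀.IsHaarMeasure] [τ₀.IsInvInvariant]
    (h1 : τ₀ (compactCore ↥(epsCentralizer (epsLoc L (splitFormGL L) v) δ₀)) = 1)
    (φ : GtLoc L v → ℂ) (hφ : Measurable φ) (β : GtLoc L v → ℂ) (hβm : Measurable β) (μ : Measure ↥T) :
    AEStronglyMeasurable (fun t : ↥T =>
      ∑ u ∈ R, classEpsOrbitalIntegral (epsLoc L (splitFormGL L) v) mGt φ
          (Quotient.mk (Relation.EqvGen.setoid (epsConjModRel (epsLoc L (splitFormGL L) v) ⊥)) ((s t * u : ↥(Subgroup.centralizer ({(γ₀.val : GtLoc L v)} : Set (GtLoc L v)))) : GtLoc L v)) *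
        β ((s t * u : ↥(Subgroup.centralizer ({(γ₀.val : GtLoc L v)} : Set (GtLoc L v)))) : GtLoc L v))
      (μ.restrict {t : ↥T | IsRegularElt (((t : (UnitaryGroup.cmDatum L 3 (splitFormGL L : Matrix (Fin 3) (Fin 3) L)).Local v)).val : GtLoc L v)}) := by
  classical
  have hΦ := splitFormGL_isHermitian L
  -- the base quotient and THE measure `μ₀ = dνGt ∕ dτ₀`
  haveI : SecondCountableTopology (GtLoc L v ⧸ epsCentralizer (epsLoc L (splitFormGL L) v) δ₀) :=
    (QuotientGroup.isQuotientMap_mk _).secondCountableTopology QuotientGroup.isOpenMap_coe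
  haveI : LocallyCompactSpace (GtLoc L v ⧸ epsCentralizer (epsLoc L (splitFormGL L) v) δ₀) := QuotientGroup.instLocallyCompactSpace _
  haveI : SigmaCompactSpace (GtLoc L v ⧸ epsCentralizer (epsLoc L (splitFormGL L) v) δ₀) := sigmaCompactSpace_of_locallyCompact_secondCountable
  haveI : SigmaFinite (quotientMeasure (epsCentralizer (epsLoc L (splitFormGL L) v) δ₀) τ₀ (isClosed_epsCentralizer L (splitFormGL L) v δ₀) νGt) :=
    SigmaFinite.of_isFiniteMeasureOnCompacts _
  -- `T^{reg}` is Borel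
  obtain ⟨w⟩ := (inferInstance : Nonempty (PlacesOver L v))
  have hregm : MeasurableSet {t : ↥T | IsRegularElt (((t : (UnitaryGroup.cmDatum L 3 (splitFormGL L : Matrix (Fin 3) (Fin 3) L)).Local v)).val : GtLoc L v)} :=
    ((isOpen_setOf_isRegularElt_cmDatum_local (L := L) (H := (splitFormGL L : Matrix (Fin 3) (Fin 3) L)) (v := v) w (hns w)).preimage continuous_subtype_val).measurableSet
  -- the globally strongly measurable model: base integrals in place of the class integrals
  have hG : Measurable fun t : ↥T =>
      ∑ u ∈ R, (∫ q, descEpsConj (epsLoc L (splitFormGL L) v) ((s t * u : ↥(Subgroup.centralizer ({(γ₀.val : GtLoc L v)} : Set (GtLoc L v)))) : GtLoc L v)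
          (epsCentralizer (epsLoc L (splitFormGL L) v) δ₀) φ q
            ∂(quotientMeasure (epsCentralizer (epsLoc L (splitFormGL L) v) δ₀) τ₀ (isClosed_epsCentralizer L (splitFormGL L) v δ₀) νGt)) *
        β ((s t * u : ↥(Subgroup.centralizer ({(γ₀.val : GtLoc L v)} : Set (GtLoc L v)))) : GtLoc L v) := by
    refine Finset.measurable_sum R fun u _ => ?_
    exact (stronglyMeasurable_integral_descEpsConj_sheet Ψ hΨ s hsm φ hφ _ u).measurable.mul
      (hβm.comp (measurable_subtype_coe.comp (hsm.mul_const u)))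
  refine hG.aestronglyMeasurable.congr ?_
  -- on `T^{reg}` the two agree summand by summand (CAN-ID at the ε-regular sheet point `s t * u`)
  filter_upwards [ae_restrict_mem hregm] with t ht
  refine Finset.sum_congr rfl fun u hu => ?_
  rw [hcan.classEpsOrbitalIntegral_mk_eq_integral_descEpsConj_base hΦ hγ₀ hδ₀T hδ₀reg τ₀ h1 (s t * u).2
    (isEpsRegularAt_of_mem_sheetTransversal hγ₀ s hsN R hRN ⟨t, ht, u, hu, rfl⟩) φ]

/-! ## §3 The head: `t ↦ Φ^{st}_ε(sec₀ t, φ) · β(sec₀ t)` is a.e.-strongly measurable on `T^{reg}` -/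

include hns hγ₀ hT hδ₀T hδ₀reg hΨ hsm hsN hRN hRcov hRinj in
/-- **(MEAS-Φst) — THE TORUS-SIDE INTEGRAND OF THE TWISTED WEYL INTEGRATION FORMULA IS a.e.-STRONGLY MEASURABLE ON `T^{reg}`.**  For an ε-canonical family `mGt` (★ β: base point
`δ₀ ∈ T̃` ε-regular, `τ₀` THE normalised Haar measure of `T′ = G̃_{δ₀ε}`), a Borel norm section `s` and representatives `R` of `K_T` (★ PART 1's letters), Borel `φ`, a Borel ε-STABLE
class function `β`, ANY everywhere-norm section `sec₀` over `T` (`t ∈ 𝒩(sec₀ t)`; no measurability of `sec₀` is assumed) and ANY measure `μ` on `T`: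
`t ↦ Φ^{st}_ε(sec₀ t, φ) · β(sec₀ t)` is a.e.-strongly measurable for `μ|_{T^{reg}}` — on `T^{reg}` it IS the sheet sum of §2 by ★ PART 1 `sum_sheet_classEpsOrbitalIntegral_mul_eq`.
So the right-hand side `∫_{T^{reg}} D_T(t) Φ^{st}_ε(sec₀ t, φ) β(sec₀ t) dt_T` of (B1) is an honest Bochner integral. [cite: Rogawski1990, §12.5 p. 186; §4.10 (4.10.1) p. 57; §3.11 Prop. 3.11.2 pp. 34–35] -/
theorem aestronglyMeasurable_stableEpsOrbitalIntegral_mul_of_sheets (hcan : IsEpsCanonicalAt L (splitFormGL L) v νGt mGt)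
    (τ₀ : Measure ↥(epsCentralizer (epsLoc L (splitFormGL L) v) δ₀)) [τ₀.IsHaarMeasure] [τ₀.IsInvInvariant]
    (h1 : τ₀ (compactCore ↥(epsCentralizer (epsLoc L (splitFormGL L) v) δ₀)) = 1)
    (φ : GtLoc L v → ℂ) (hφ : Measurable φ) (β : GtLoc L v → ℂ)
    (hβ : ∀ δ δ' : GtLoc L v, IsStablyEpsConjAt L (splitFormGL L) v δ δ' → β δ = β δ') (hβm : Measurable β)
    (sec₀ : (UnitaryGroup.cmDatum L 3 (splitFormGL L : Matrix (Fin 3) (Fin 3) L)).Local v → GtLoc L v)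
    (hsec₀ : ∀ t : ↥T, IsEpsNormPair L (splitFormGL L) v (sec₀ t) (t : (UnitaryGroup.cmDatum L 3 (splitFormGL L : Matrix (Fin 3) (Fin 3) L)).Local v))
    (μ : Measure ↥T) :
    AEStronglyMeasurable (fun t : ↥T => stableEpsOrbitalIntegral L (splitFormGL L) v mGt φ (sec₀ t) * β (sec₀ t))
      (μ.restrict {t : ↥T | IsRegularElt (((t : (UnitaryGroup.cmDatum L 3 (splitFormGL L : Matrix (Fin 3) (Fin 3) L)).Local v)).val : GtLoc L v)}) := by
  classical
  -- `T^{reg}` is Borel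
  obtain ⟨w⟩ := (inferInstance : Nonempty (PlacesOver L v))
  have hregm : MeasurableSet {t : ↥T | IsRegularElt (((t : (UnitaryGroup.cmDatum L 3 (splitFormGL L : Matrix (Fin 3) (Fin 3) L)).Local v)).val : GtLoc L v)} :=
    ((isOpen_setOf_isRegularElt_cmDatum_local (L := L) (H := (splitFormGL L : Matrix (Fin 3) (Fin 3) L)) (v := v) w (hns w)).preimage continuous_subtype_val).measurableSet
  refine (aestronglyMeasurable_sum_sheet_classEpsOrbitalIntegral_mul hns hγ₀ hδ₀T hδ₀reg Ψ hΨ s hsm hsN R hRN hcan τ₀ h1 φ hφ β hβm μ).congr ?_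
  -- pointwise on `T^{reg}`: ★ PART 1 at `δ₀ := sec₀ t`
  filter_upwards [ae_restrict_mem hregm] with t ht
  exact sum_sheet_classEpsOrbitalIntegral_mul_eq hγ₀ hT s hsN R hRN hRcov hRinj mGt φ β hβ t ht (hsec₀ t)

end MeasPhiSt

end Summit.HodgeConjecture.HodgeConjecture.R90.S4

end
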